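import Literature.NumberTheory.DiophantineGeometry.SchurWeylPlethysmIrreducibleProofs
import Literature.NumberTheory.DiophantineGeometry.KroneckerOneRow
import HarnessLib

/-!
# The Weyl module of a one-row partition is the space of forms: `S_{(d)}(k^σ) ≅ Sym^d(k^σ)`

Topic `NumberTheory/DiophantineGeometry` (next to `SchurWeylPlethysm`); namespace
`Literature.NumberTheory.DiophantineGeometry`.  Definitions with bodies and theorems; no named
fact, no instance, no `sorry`.

Weyl's construction (`weylModule k σ μ = c_μ · (k^σ)^{⊗d}`, `weylRep`) for the ONE-ROW partition
`μ = (d)` (Mathlib `Nat.Partition.indiscrete d`) gives the symmetric tensors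
(`c_{(d)} = ∑_{g ∈ 𝔖_d} e_g`, [FultonHarrisGTM129, §4.1 after (4.3)] — `youngSymmetrizer_indiscrete`),
i.e. `S_{(d)} V = Sym^d V` ([FultonHarrisGTM129, §6.1, Thm. 6.3 and the example following it:
"`S_{(d)} V = Sym^d V`, `S_{(1,…,1)} V = ∧^d V`"]).  In the tree, `Sym^d` of the standard column
representation of `GL σ k` is realised on FORMS of degree `d` in the variables `X_i`
(`Literature.Computability.AlgebraicComplexity.formRep σ k d` on
`MvPolynomial.homogeneousSubmodule σ k d`, `X_i ↦ ∑_j g_{ji} X_j`; for `σ = Fin 2` this is the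
`SymPow` of `IntegralWeightHeckeModuleGL2` and the coefficient module `V_{(k−2,0)}` of
`CuspidalCohomologyGL` / `BianchiOrdinaryClassicality` is `weylRep` of the one-row partition).
This file constructs the comparison:

* `linForm σ k v = ∑_j v_j X_j`, `tensorToPoly σ k d : (k^σ)^{⊗d} → k[X]`,
  `v_1 ⊗ ⋯ ⊗ v_d ↦ ∏_i linForm v_i` (multilinear: `PiTensorProduct.lift` of
  `MultilinearMap.mkPiAlgebra`), landing in forms of degree `d` (`tensorToForm`); it is
  `𝔖_d`-invariant (`tensorToPoly_permTensorRep`) and `GL σ k`-EQUIVARIANT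
  (`tensorToPoly_glTensorRep`: `linSubst g (linForm v) = linForm (g v)`);
* `youngSymmetrizer_indiscrete`, `weylModule_indiscrete` — `c_{(d)} = ∑_g e_g` and
  `S_{(d)}(k^σ) = range (∑_g g)` (row stabiliser `= 𝔖_d`, column stabiliser trivial:
  `rowStabilizer_indiscrete`, `colStabilizer_indiscrete` of `KroneckerOneRow`);
* `weylToForm` — the restriction `S_{(d)}(k^σ) → Sym^d`, an intertwining map
  (`weylToFormIntertwining`), NON-ZERO (`∑_g g · e_i^{⊗d} ↦ d! X_i^d`) hence INJECTIVE in
  characteristic zero by the irreducibility of Weyl modules PROVED in the tree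
  (`isIrreducible_weylRep_holds`, [FultonHarrisGTM129, Thm. 6.3 (4)]) and Schur
  (`Representation.IsIrreducible.injective_or_eq_zero`);
* for `σ = Fin 2`: SURJECTIVE (`X₀^a X₁^{d−a} = (d!)⁻¹ · Θ(∑_g g · e_f)` for the step function
  `f`, and the monomials span the binary forms of degree `d`), whence the `GL₂(k)`-equivariant
  isomorphism **`weylFormEquiv k d : S_{(d)}(k²) ≃ Sym^d(k²)`** (`Representation.Equiv` between
  `weylRep k (Fin 2) (indiscrete d)` and `formRep (Fin 2) k d`), `k` a field of characteristic `0`.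

## References

* W. Fulton, J. Harris, *Representation Theory. A First Course*, GTM 129 (1991), §4.1 (after
  (4.3)), §6.1 Thm. 6.3 (and the examples after it), §15.5. [FultonHarrisGTM129]
* W. Fulton, *Young Tableaux*, LMS Student Texts 35 (1997), §8.1. [FultonYoungTableaux1997]
-/

noncomputable section

open scoped BigOperators TensorProduct
open MvPolynomial

namespace Literature.NumberTheory.DiophantineGeometry

open Literature.Computability.AlgebraicComplexity

/-! ### The multiplication map `(k^σ)^{⊗d} → k[X]_d` -/

section General

variable (σ k : Type*) [Fintype σ] [CommRing k] (d : ℕ)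

/-- The linear form `v ↦ ∑_j v_j X_j` attached to a column vector `v ∈ k^σ` (the identification
of the standard representation `k^σ` with the forms of degree `1`). [folklore] -/
def linForm : (σ → k) →ₗ[k] MvPolynomial σ k where
  toFun v := ∑ j, v j • X j
  map_add' v w := by
    simp only [Pi.add_apply, add_smul, Finset.sum_add_distrib]
  map_smul' c v := by
    simp only [Pi.smul_apply, smul_eq_mul, mul_smul, Finset.smul_sum, RingHom.id_apply]

/-- Unfolding lemma for `linForm`. [folklore] -/
theorem linForm_apply (v : σ → k) : linForm σ k v = ∑ j, v j • X j :=
  rfl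

/-- `linForm (e_i) = X_i`. [folklore] -/
@[simp]
theorem linForm_single [DecidableEq σ] (i : σ) : linForm σ k (Pi.single i 1) = X i := by
  rw [linForm_apply, Finset.sum_eq_single i (fun j _ hj => by rw [Pi.single_eq_of_ne hj, zero_smul])
    (fun h => absurd (Finset.mem_univ i) h), Pi.single_eq_same, one_smul]

/-- `linForm v` is a form of degree `1`. [folklore] -/
theorem linForm_mem (v : σ → k) : linForm σ k v ∈ homogeneousSubmodule σ k 1 :=
  Submodule.sum_mem _ fun j _ =>
    Submodule.smul_mem _ _ ((mem_homogeneousSubmodule 1 _).2 (isHomogeneous_X k j))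

/-- **`linSubst g (linForm v) = linForm (g v)`**: the linear forms of degree one ARE the standard
column representation (`X_i ↦ ∑_j g_{ji} X_j` versus `v ↦ g *ᵥ v`). [folklore] -/
theorem linSubst_linForm (A : Matrix σ σ k) (v : σ → k) :
    linSubst σ k A (linForm σ k v) = linForm σ k (A.mulVec v) := by
  simp only [linForm_apply, map_sum, map_smul, linSubst_X, Matrix.mulVec, dotProduct,
    Finset.smul_sum, smul_smul, Finset.sum_smul]
  rw [Finset.sum_comm]
  refine Finset.sum_congr rfl fun i _ => Finset.sum_congr rfl fun j _ => ?_
  rw [mul_comm]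

/-- **The multiplication map `Θ : (k^σ)^{⊗d} → k[X]`, `v_1 ⊗ ⋯ ⊗ v_d ↦ ∏_i linForm v_i`**
(multilinear in the factors). [cite: FultonHarrisGTM129, §6.1 (Sym^d V as a quotient of V^{⊗d})] -/
def tensorToPoly : TensorPower k d (σ → k) →ₗ[k] MvPolynomial σ k :=
  PiTensorProduct.lift
    ((MultilinearMap.mkPiAlgebra k (Fin d) (MvPolynomial σ k)).compLinearMap fun _ => linForm σ k)

/-- `Θ` on a pure tensor. [folklore] -/
@[simp]
theorem tensorToPoly_tprod (v : Fin d → σ → k) :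
    tensorToPoly σ k d (PiTensorProduct.tprod k v) = ∏ i, linForm σ k (v i) := by
  simp [tensorToPoly, PiTensorProduct.lift.tprod, MultilinearMap.mkPiAlgebra_apply]

/-- `Θ` lands in the forms of degree `d`. [folklore] -/
theorem tensorToPoly_mem (t : TensorPower k d (σ → k)) :
    tensorToPoly σ k d t ∈ homogeneousSubmodule σ k d := by
  induction t using PiTensorProduct.induction_on with
  | smul_tprod r v =>
    rw [map_smul]
    refine Submodule.smul_mem _ _ ?_
    rw [tensorToPoly_tprod, mem_homogeneousSubmodule]
    have h := IsHomogeneous.prod Finset.univ (fun i => linForm σ k (v i)) (fun _ => 1)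
      fun i _ => (mem_homogeneousSubmodule 1 _).1 (linForm_mem σ k (v i))
    simpa using h
  | add x y hx hy =>
    rw [map_add]
    exact Submodule.add_mem _ hx hy

/-- `Θ` as a map to the forms of degree `d` (`Sym^d` of the tree: `homogeneousSubmodule σ k d`).
[folklore] -/
def tensorToForm : TensorPower k d (σ → k) →ₗ[k] homogeneousSubmodule σ k d :=
  LinearMap.codRestrict _ (tensorToPoly σ k d) (tensorToPoly_mem σ k d)

/-- Unfolding lemma for `tensorToForm`. [folklore] -/
@[simp]
theorem coe_tensorToForm_apply (t : TensorPower k d (σ → k)) :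
    (tensorToForm σ k d t : MvPolynomial σ k) = tensorToPoly σ k d t :=
  rfl

/-- **`Θ` is `𝔖_d`-invariant**: permuting the factors does not change the product. [folklore] -/
theorem tensorToPoly_permTensorRep (τ : Equiv.Perm (Fin d)) (t : TensorPower k d (σ → k)) :
    tensorToPoly σ k d (permTensorRep k (σ → k) d τ t) = tensorToPoly σ k d t := by
  induction t using PiTensorProduct.induction_on with
  | smul_tprod r v =>
    simp only [map_smul, permTensorRep_tprod, tensorToPoly_tprod]
    congr 1
    exact Equiv.prod_comp τ.symm (fun i => linForm σ k (v i))
  | add x y hx hy => simp only [map_add, hx, hy]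

/-- **`Θ` is `GL σ k`-equivariant** from the diagonal action on tensors to linear substitution of
variables: `Θ (g · t) = linSubst g (Θ t)`. [cite: FultonHarrisGTM129, §6.1] -/
theorem tensorToPoly_glTensorRep [DecidableEq σ] (g : GL σ k) (t : TensorPower k d (σ → k)) :
    tensorToPoly σ k d (glTensorRep σ k d g t) =
      linSubst σ k (g : Matrix σ σ k) (tensorToPoly σ k d t) := by
  induction t using PiTensorProduct.induction_on with
  | smul_tprod r v =>
    simp only [map_smul, glTensorRep_tprod, tensorToPoly_tprod, map_prod, linSubst_linForm]
  | add x y hx hy => simp only [map_add, hx, hy]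

/-- The symmetrisation `∑_{g ∈ 𝔖_d} g` on `V^{⊗d}`. [cite: FultonHarrisGTM129, §4.1 and §6.1] -/
def symmetrizeT (V : Type*) [AddCommGroup V] [Module k V] : TensorPower k d V →ₗ[k] TensorPower k d V :=
  ∑ τ : Equiv.Perm (Fin d), permTensorRep k V d τ

/-- Unfolding lemma for `symmetrizeT`. [folklore] -/
theorem symmetrizeT_apply {V : Type*} [AddCommGroup V] [Module k V] (t : TensorPower k d V) :
    symmetrizeT k d V t = ∑ τ : Equiv.Perm (Fin d), permTensorRep k V d τ t := by
  rw [symmetrizeT, LinearMap.sum_apply]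

/-- **`Θ ∘ (∑_g g) = d! · Θ`** (`Θ` is `𝔖_d`-invariant and `|𝔖_d| = d!`). [folklore] -/
theorem tensorToPoly_symmetrizeT (t : TensorPower k d (σ → k)) :
    tensorToPoly σ k d (symmetrizeT k d (σ → k) t) = (d.factorial : k) • tensorToPoly σ k d t := by
  rw [symmetrizeT_apply, map_sum]
  simp_rw [tensorToPoly_permTensorRep]
  rw [Finset.sum_const, Finset.card_univ, Fintype.card_perm, Fintype.card_fin, Nat.cast_smul_eq_nsmul]

/-- `symmetrizeT` commutes with the diagonal `GL`-action. [folklore] -/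
theorem symmetrizeT_glTensorRep [DecidableEq σ] (g : GL σ k) (t : TensorPower k d (σ → k)) :
    symmetrizeT k d (σ → k) (glTensorRep σ k d g t) = glTensorRep σ k d g (symmetrizeT k d (σ → k) t) := by
  rw [symmetrizeT_apply, symmetrizeT_apply, map_sum]
  refine Finset.sum_congr rfl fun τ _ => ?_
  exact LinearMap.congr_fun (permTensorRep_comp_glTensorRep σ k d τ g) t

/-- `Θ (∑_g g · e_i^{⊗d}) = d! · X_i^d`. [folklore] -/
theorem tensorToPoly_symmetrizeT_tprod_single [DecidableEq σ] (i : σ) :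
    tensorToPoly σ k d (symmetrizeT k d (σ → k) (PiTensorProduct.tprod k fun _ : Fin d => Pi.single i 1)) =
      (d.factorial : k) • (X i ^ d : MvPolynomial σ k) := by
  rw [tensorToPoly_symmetrizeT, tensorToPoly_tprod]
  simp

end General

/-! ### The Weyl module of the one-row partition -/

section Weyl

variable (σ k : Type*) [Fintype σ] [LinearOrder σ] [Field k] (d : ℕ)

open scoped Classical in
/-- `a_{(d)} = ∑_{g ∈ 𝔖_d} e_g`: the row stabiliser of the one-row tableau is everything.
[cite: FultonHarrisGTM129, §4.1 (after (4.3))] -/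
theorem rowSymmetrizer_indiscrete :
    rowSymmetrizer k (Nat.Partition.indiscrete d) =
      ∑ τ : Equiv.Perm (Fin d), MonoidAlgebra.of k (Equiv.Perm (Fin d)) τ := by
  unfold rowSymmetrizer
  have hS : (rowStabilizer (Nat.Partition.indiscrete d) : Set (Equiv.Perm (Fin d))).toFinset =
      Finset.univ := by
    ext τ
    simp [rowStabilizer_indiscrete]
  rw [hS]

open scoped Classical in
/-- `b_{(d)} = 1`: the column stabiliser of the one-row tableau is trivial.
[cite: FultonHarrisGTM129, §4.1 (after (4.3))] -/
theorem colAntisymmetrizer_indiscrete : colAntisymmetrizer k (Nat.Partition.indiscrete d) = 1 := by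
  unfold colAntisymmetrizer
  have hS : (colStabilizer (Nat.Partition.indiscrete d) : Set (Equiv.Perm (Fin d))).toFinset = {1} := by
    ext τ
    simp [colStabilizer_indiscrete]
  rw [hS, Finset.sum_singleton, Equiv.Perm.sign_one, Units.val_one, Int.cast_one, one_smul,
    MonoidAlgebra.one_def]
  rfl

/-- **`c_{(d)} = ∑_{g ∈ 𝔖_d} e_g`.** [cite: FultonHarrisGTM129, §4.1 (after (4.3))] -/
theorem youngSymmetrizer_indiscrete :
    youngSymmetrizer k (Nat.Partition.indiscrete d) =
      ∑ τ : Equiv.Perm (Fin d), MonoidAlgebra.of k (Equiv.Perm (Fin d)) τ := by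
  rw [youngSymmetrizer, colAntisymmetrizer_indiscrete, mul_one, rowSymmetrizer_indiscrete]

/-- `c_{(d)}` acts on `V^{⊗d}` as the symmetrisation `∑_g g`. [folklore] -/
theorem asAlgebraHom_youngSymmetrizer_indiscrete (V : Type*) [AddCommGroup V] [Module k V] :
    (permTensorRep k V d).asAlgebraHom (youngSymmetrizer k (Nat.Partition.indiscrete d)) =
      symmetrizeT k d V := by
  rw [youngSymmetrizer_indiscrete, map_sum]
  simp_rw [Representation.asAlgebraHom_of]
  rfl

omit [Fintype σ] [LinearOrder σ] in
/-- **`S_{(d)}(k^σ)` is the space of symmetrised tensors `(∑_g g) · (k^σ)^{⊗d}`.**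
[cite: FultonHarrisGTM129, §6.1 Thm. 6.3 (S_{(d)} V = Sym^d V)] -/
theorem weylModule_indiscrete :
    weylModule k σ (Nat.Partition.indiscrete d) = LinearMap.range (symmetrizeT k d (σ → k)) := by
  rw [weylModule, asAlgebraHom_youngSymmetrizer_indiscrete]

/-- The one-row partition has at most one part. [folklore] -/
theorem card_parts_indiscrete_le_one : (Nat.Partition.indiscrete d).parts.card ≤ 1 := by
  by_cases hd : d = 0
  · subst hd
    rw [Nat.Partition.partition_zero_parts]
    simp
  · rw [Nat.Partition.indiscrete_parts hd, Multiset.card_singleton]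

/-- The restriction of `Θ` to the Weyl module: `S_{(d)}(k^σ) → Sym^d(k^σ)`. [folklore] -/
def weylToForm : weylModule k σ (Nat.Partition.indiscrete d) →ₗ[k] homogeneousSubmodule σ k d :=
  tensorToForm σ k d ∘ₗ (weylModule k σ (Nat.Partition.indiscrete d)).subtype

omit [LinearOrder σ] in
/-- Unfolding lemma for `weylToForm`. [folklore] -/
@[simp]
theorem coe_weylToForm_apply (x : weylModule k σ (Nat.Partition.indiscrete d)) :
    (weylToForm σ k d x : MvPolynomial σ k) = tensorToPoly σ k d x :=
  rfl

/-- **`weylToForm` is `GL σ k`-equivariant** (`weylRep → formRep`). [cite: FultonHarrisGTM129, §6.1] -/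
theorem weylToForm_weylRep (g : GL σ k) (x : weylModule k σ (Nat.Partition.indiscrete d)) :
    weylToForm σ k d (weylRep k σ _ g x) = formRep σ k d g (weylToForm σ k d x) := by
  refine Subtype.ext ?_
  rw [coe_weylToForm_apply, coe_weylRep_apply, tensorToPoly_glTensorRep]
  rfl

/-- `weylToForm` as an intertwining map `weylRep → formRep`. [folklore] -/
def weylToFormIntertwining :
    Representation.IntertwiningMap (weylRep k σ (Nat.Partition.indiscrete d)) (formRep σ k d) where
  toLinearMap := weylToForm σ k d
  isIntertwining' g := LinearMap.ext fun x => weylToForm_weylRep σ k d g x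

/-- Unfolding lemma for `weylToFormIntertwining`. [folklore] -/
@[simp]
theorem weylToFormIntertwining_apply (x : weylModule k σ (Nat.Partition.indiscrete d)) :
    weylToFormIntertwining σ k d x = weylToForm σ k d x :=
  rfl

omit [Fintype σ] in
/-- The symmetrised tensor `∑_g g · e_i^{⊗d}` lies in the Weyl module. [folklore] -/
theorem symmetrizeT_tprod_single_mem (i : σ) :
    symmetrizeT k d (σ → k) (PiTensorProduct.tprod k fun _ : Fin d => Pi.single i 1) ∈
      weylModule k σ (Nat.Partition.indiscrete d) := by
  rw [weylModule_indiscrete]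
  exact LinearMap.mem_range_self _ _

/-- **`weylToForm ≠ 0`** in characteristic zero: `∑_g g · e_i^{⊗d} ↦ d! X_i^d ≠ 0`. [folklore] -/
theorem weylToForm_ne_zero [CharZero k] [Nonempty σ] : weylToForm σ k d ≠ 0 := by
  obtain ⟨i⟩ := ‹Nonempty σ›
  intro h
  have h1 := congrArg (fun f : weylModule k σ (Nat.Partition.indiscrete d) →ₗ[k] homogeneousSubmodule σ k d =>
    ((f ⟨_, symmetrizeT_tprod_single_mem σ k d i⟩ : homogeneousSubmodule σ k d) : MvPolynomial σ k)) h
  simp only [coe_weylToForm_apply, LinearMap.zero_apply, Submodule.coe_zero,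
    tensorToPoly_symmetrizeT_tprod_single] at h1
  refine (smul_ne_zero (Nat.cast_ne_zero.2 (Nat.factorial_ne_zero d)) ?_) h1
  rw [X_pow_eq_monomial, Ne, monomial_eq_zero]
  exact one_ne_zero

/-- **`weylToForm` is injective** in characteristic zero: a non-zero intertwining map out of the
IRREDUCIBLE Weyl module (`isIrreducible_weylRep_holds`, the one-row partition having at most one
part) is injective (Schur). [cite: FultonHarrisGTM129, Thm. 6.3 (4)] -/
theorem weylToForm_injective [CharZero k] [Nonempty σ] : Function.Injective (weylToForm σ k d) := by
  haveI := isIrreducible_weylRep_holds k σ (Nat.Partition.indiscrete d)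
    ((card_parts_indiscrete_le_one d).trans (Fintype.card_pos_iff.2 ‹Nonempty σ›))
  rcases Representation.IsIrreducible.injective_or_eq_zero (V := weylModule k σ (Nat.Partition.indiscrete d))
      (W := homogeneousSubmodule σ k d) (ρ := weylRep k σ (Nat.Partition.indiscrete d)) (σ := formRep σ k d)
      (weylToFormIntertwining σ k d) with h | h
  · exact h
  · exact absurd (LinearMap.ext fun x => by
      rw [← weylToFormIntertwining_apply, h]; rfl) (weylToForm_ne_zero σ k d)

end Weyl

/-! ### Binary forms: surjectivity and the isomorphism `S_{(d)}(k²) ≃ Sym^d(k²)` -/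

section Binary

variable (k : Type*) [Field k] (d : ℕ)

/-- The number of `i : Fin d` below `a ≤ d` is `a`. [folklore] -/
theorem card_filter_val_lt {a : ℕ} (ha : a ≤ d) :
    (Finset.univ.filter fun i : Fin d => (i : ℕ) < a).card = a := by
  have h : (Finset.univ.filter fun i : Fin d => (i : ℕ) < a) = Finset.univ.map (Fin.castLEEmb ha) := by
    ext i
    simp only [Finset.mem_filter, Finset.mem_univ, true_and, Finset.mem_map, Fin.castLEEmb_apply]
    constructor
    · intro hi
      exact ⟨⟨i, hi⟩, Fin.ext rfl⟩
    · rintro ⟨j, rfl⟩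
      exact j.2
  rw [h, Finset.card_map, Finset.card_univ, Fintype.card_fin]

/-- The step tensor `e_0^{⊗a} ⊗ e_1^{⊗(d−a)}` maps to the monomial `X₀^a X₁^{d−a}`. [folklore] -/
theorem tensorToPoly_tprod_step {a : ℕ} (ha : a ≤ d) :
    tensorToPoly (Fin 2) k d (PiTensorProduct.tprod k fun i : Fin d =>
        Pi.single (if (i : ℕ) < a then (0 : Fin 2) else 1) 1) =
      X 0 ^ a * X 1 ^ (d - a) := by
  rw [tensorToPoly_tprod]
  have h1 : ∀ i : Fin d, linForm (Fin 2) k (Pi.single (if (i : ℕ) < a then (0 : Fin 2) else 1) 1) =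
      if (i : ℕ) < a then X 0 else X 1 := by
    intro i
    split_ifs <;> simp
  simp_rw [h1]
  rw [Finset.prod_ite, Finset.prod_const, Finset.prod_const, card_filter_val_lt d ha]
  congr 2
  have h2 := Finset.card_filter_add_card_filter_not
    (s := (Finset.univ : Finset (Fin d))) (fun i : Fin d => (i : ℕ) < a)
  rw [card_filter_val_lt d ha, Finset.card_univ, Fintype.card_fin] at h2
  omega

/-- **Every monomial `X₀^a X₁^{d−a}` is in the image of the Weyl module** (characteristic zero:
`X₀^a X₁^{d−a} = (d!)⁻¹ Θ(∑_g g · e_f)` for the step function `f`). [folklore] -/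
theorem monomial_mem_range_weylToForm [CharZero k] {a : ℕ} (ha : a ≤ d) :
    ∃ x : weylModule k (Fin 2) (Nat.Partition.indiscrete d),
      (weylToForm (Fin 2) k d x : MvPolynomial (Fin 2) k) = X 0 ^ a * X 1 ^ (d - a) := by
  set t : TensorPower k d (Fin 2 → k) :=
    PiTensorProduct.tprod k fun i : Fin d => Pi.single (if (i : ℕ) < a then (0 : Fin 2) else 1) 1 with ht
  have hmem : symmetrizeT k d (Fin 2 → k) t ∈ weylModule k (Fin 2) (Nat.Partition.indiscrete d) := by
    rw [weylModule_indiscrete]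
    exact LinearMap.mem_range_self _ _
  refine ⟨((d.factorial : k)⁻¹) • ⟨_, hmem⟩, ?_⟩
  rw [map_smul, Submodule.coe_smul, coe_weylToForm_apply, Submodule.coe_mk, tensorToPoly_symmetrizeT,
    smul_smul, inv_mul_cancel₀ (Nat.cast_ne_zero.2 (Nat.factorial_ne_zero d)), one_smul, ht,
    tensorToPoly_tprod_step k d ha]

/-- A monomial in two variables: `monomial s c = c • X₀^{s 0} X₁^{s 1}`. [folklore] -/
theorem monomial_fin_two (s : Fin 2 →₀ ℕ) (c : k) :
    (monomial s c : MvPolynomial (Fin 2) k) = c • (X 0 ^ s 0 * X 1 ^ s 1) := by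
  have hs : s = Finsupp.single 0 (s 0) + Finsupp.single 1 (s 1) := by
    ext i
    fin_cases i <;> simp
  conv_lhs => rw [hs]
  rw [X_pow_eq_monomial, X_pow_eq_monomial, monomial_mul, mul_one, smul_monomial, smul_eq_mul, mul_one]

/-- **`weylToForm` is surjective onto the binary forms of degree `d`** (characteristic zero).
[cite: FultonHarrisGTM129, §6.1 Thm. 6.3 (S_{(d)} V = Sym^d V)] -/
theorem weylToForm_surjective [CharZero k] : Function.Surjective (weylToForm (Fin 2) k d) := by
  intro y
  -- the image is a submodule of `k[X₀, X₁]` containing every monomial of degree `d`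
  set S : Submodule k (MvPolynomial (Fin 2) k) :=
    (LinearMap.range (weylToForm (Fin 2) k d)).map (homogeneousSubmodule (Fin 2) k d).subtype with hS
  suffices h : (y : MvPolynomial (Fin 2) k) ∈ S by
    obtain ⟨z, ⟨x, rfl⟩, hz⟩ := h
    exact ⟨x, Subtype.ext hz⟩
  have hmono : ∀ s : Fin 2 →₀ ℕ, s.degree = d → (monomial s (coeff s (y : MvPolynomial (Fin 2) k))) ∈ S := by
    intro s hsd
    have ha : s 0 ≤ d := by
      rw [← hsd, Finsupp.degree_eq_sum, Fin.sum_univ_two]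
      omega
    have hb : s 1 = d - s 0 := by
      rw [← hsd, Finsupp.degree_eq_sum, Fin.sum_univ_two]
      omega
    obtain ⟨x, hx⟩ := monomial_mem_range_weylToForm k d ha
    rw [monomial_fin_two, hb, ← hx]
    exact Submodule.smul_mem _ _ ⟨weylToForm (Fin 2) k d x, LinearMap.mem_range_self _ _, rfl⟩
  have hy : (y : MvPolynomial (Fin 2) k).IsHomogeneous d := (mem_homogeneousSubmodule d _).1 y.2
  rw [(y : MvPolynomial (Fin 2) k).as_sum]
  refine Submodule.sum_mem _ fun s hs => hmono s ?_
  have hc : coeff s (y : MvPolynomial (Fin 2) k) ≠ 0 := mem_support_iff.1 hs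
  have := hy hc
  rw [Finsupp.degree_eq_weight_one]
  exact this

/-- **`S_{(d)}(k²) ≃ Sym^d(k²)`**, the linear equivalence (characteristic zero). [cite: FultonHarrisGTM129, §6.1 Thm. 6.3] -/
def weylFormLinearEquiv [CharZero k] :
    weylModule k (Fin 2) (Nat.Partition.indiscrete d) ≃ₗ[k] homogeneousSubmodule (Fin 2) k d :=
  LinearEquiv.ofBijective (weylToForm (Fin 2) k d)
    ⟨weylToForm_injective (Fin 2) k d, weylToForm_surjective k d⟩

/-- Unfolding lemma for `weylFormLinearEquiv`. [folklore] -/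
@[simp]
theorem weylFormLinearEquiv_apply [CharZero k] (x : weylModule k (Fin 2) (Nat.Partition.indiscrete d)) :
    weylFormLinearEquiv k d x = weylToForm (Fin 2) k d x :=
  rfl

/-- **`S_{(d)}(k²) ≅ Sym^d(k²)` as representations of `GL₂(k)`**: the Weyl module of the one-row
partition `(d)` (`weylRep k (Fin 2) (indiscrete d)`) is the `d`-th symmetric power of the standard
representation, realised on binary forms of degree `d` (`formRep (Fin 2) k d`), for `k` a field of
characteristic zero. [cite: FultonHarrisGTM129, §6.1 Thm. 6.3 (S_{(d)} V = Sym^d V) and §15.5] -/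
def weylFormEquiv [CharZero k] :
    Representation.Equiv (weylRep k (Fin 2) (Nat.Partition.indiscrete d)) (formRep (Fin 2) k d) :=
  Representation.Equiv.mk (weylFormLinearEquiv k d) fun g =>
    LinearMap.ext fun x => weylToForm_weylRep (Fin 2) k d g x

/-- Unfolding lemma for `weylFormEquiv`. [folklore] -/
@[simp]
theorem weylFormEquiv_apply [CharZero k] (x : weylModule k (Fin 2) (Nat.Partition.indiscrete d)) :
    weylFormEquiv k d x = weylToForm (Fin 2) k d x :=
  rfl

/-- Equivariance of `weylFormEquiv`, pointwise. [folklore] -/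
theorem weylFormEquiv_weylRep [CharZero k] (g : GL (Fin 2) k)
    (x : weylModule k (Fin 2) (Nat.Partition.indiscrete d)) :
    weylFormEquiv k d (weylRep k (Fin 2) _ g x) = formRep (Fin 2) k d g (weylFormEquiv k d x) :=
  weylToForm_weylRep (Fin 2) k d g x

end Binary

end Literature.NumberTheory.DiophantineGeometry
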